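import Mathlib
import Literature.MathematicalPhysics.StatisticalMechanics.Crystallization
import Summits.AtomisticToContinuum.Crystallization.Theses.ThreeConeCertificate
import Summits.AtomisticToContinuum.Crystallization.Theorems.ChargedEnergyGap.Negative.BlocksEnergy
import Summits.AtomisticToContinuum.Crystallization.Theorems.ThreeConeCertificateExactCertificateInvisibilitySlice
import Summits.AtomisticToContinuum.Crystallization.Theorems.ThreeConeCertificateExactCertificateInvisibilityRadial
import Summits.AtomisticToContinuum.Crystallization.Theorems.ThreeConeCertificateExactCertificateInvisibilityJensen
import Summits.AtomisticToContinuum.Crystallization.Theorems.ThreeConeCertificateExactCertificateInvisibilityCoincidence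
import Summits.AtomisticToContinuum.Crystallization.Theorems.ThreeConeCertificateExactCertificateInvisibilityNorms
import Summits.AtomisticToContinuum.Crystallization.Theorems.ThreeConeCertificateExactCertificateInvisibilityOneDim
import Summits.AtomisticToContinuum.Crystallization.Theorems.ThreeConeCertificateExactCertificateInvisibilityBragg
import Summits.AtomisticToContinuum.Crystallization.Theorems.ThreeConeCertificateExactCertificateInvisibilitySliceDim
import Summits.AtomisticToContinuum.Crystallization.Theorems.ThreeConeCertificateExactCertificateInvisibilityRadialDim
import Summits.AtomisticToContinuum.Crystallization.Theorems.ThreeConeCertificateExactCertificateInvisibility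
import Summits.AtomisticToContinuum.Crystallization.Theorems.ThreeConeCertificateExactCertificateInvisibilityDim

/-!
# Crux `ExactCertificate` (stmt-AtomisticToContinuum-11959), line `closure-makes-nogap-exact`, lead c10:
# skeleton VIII — THE INVISIBILITY DICHOTOMY (`InvisibilityDichotomy`): the far-field wall W1(α) as a theorem

Skeleton VIII v4 (c10, 2026-08-17 17:05Z) — SORRY-FREE: all eleven registered stubs LANDED and imported (assemblies `…Invisibility.lean` p164896,
`…InvisibilityDim.lean` p167143).  v3 (15:10Z): nine worker stubs imported.  v2 (13:45Z):  WAVE 1: all seven stubs LANDED (stub_sliceEntire p162765, stub_fourierRadial p162602,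
stub_jensenCount p162868, stub_coincidenceFinite p162944, stub_normsSuperlinear p163075, stub_oneDimKernel p162915,
stub_braggOfInvisible p162756; namespace `…Theorems.ThreeConeCertificateExactCertificate.Invisibility`).  They are kept below as
`sorry`s ONLY because the farm has not yet built the new modules (rc 75 `unbuilt`), so this file still elaborates against
Mathlib + the old tree; v3 imports them.  NEW in v2: the registered ASSEMBLY stub `stub_invisibilityAssembly` (= the deciding
statement, lead), and WAVE 2 — the theorem in EVERY dimension `d ≥ 2`: stubs `stub_sliceEntireDim`, `stub_fourierRadialDim`
(dimension-free versions of S1, S2), the lead's Gram-model reduction to `ℝ³` (`exists_gramModel`,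
`radial_eq_zero_of_fourier_vanish_dim`, proved below modulo the two stubs) and the registered assembly stub `stub_dimAssembly`.

The 3-D line is parked (skeleton v6 of `Lines/closure_makes_nogap_exact.lean`: the crux is `NoGap ∧ KeplerBound` by tree
theorems, `KeplerBound` = item 11961 ↔ 0627 open; nothing below is a stub of the 3-D crux).  The d = 1 exactness
mechanism of Transfer I–VII (c6–c9) is `f = α ∗ Ψ` with `α = −¼(δ_a − 2δ₀ + δ_{−a})` a FINITE-RANGE kernel that is
INVISIBLE to the chain (`Σ_{y ∈ aℤ} α(· − y) = 0`, i.e. `α̂ = −sin²(πaξ)` vanishes on the dual lattice).  STRATEGY-CENSUS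
§2a(α) and TRANSFER-1D-CLASS §2 locate the d = 1 / d = 3 break of the whole Transfer lane at exactly this operator: "no
finite-range radial invisibility operator exists in d ≥ 2".  This skeleton proves that sentence for continuous kernels,
for EVERY lattice (no arithmetic of the template is needed), together with its d = 1 negation:

  `InvisibilityDichotomy` :=
    (d = 3)  for every Bravais periodic configuration `P ⊂ ℝ³` (one-point motif) and every continuous `α : ℝ → ℝ`
             vanishing on `[L, ∞)`: if the `α`-field of the crystal vanishes identically,
             `Σ_{y ∈ P} α(dist w y) = 0` for all `w ∈ ℝ³`, then `α ≡ 0` on `[0, ∞)`;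
    (d = 1)  for every spacing `a > 0` there is a continuous `α` with `α 0 ≠ 0`, vanishing on `[L, ∞)`, whose field
             on the chain vanishes identically: `Σ_{n ∈ ℤ} α(|w − n a|) = 0` for all `w ∈ ℝ`.

Proof of the d = 3 half.  Invisibility gives `S_P(k)·𝓕A(k) = 0` at every dual-lattice vector `k` (`A := α∘‖·‖`; twist +
unfolding over a fundamental domain, as in `…StrictCertificateBragg`), and `S_P ≠ 0` for a one-point motif.  The slice
`Φ(s) := ∫ A(v) e^{−2πi s v₀} dv` is ENTIRE of exponential type (`A` has compact support) and agrees with `𝓕A(s e₀)` on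
`ℝ`; by radiality `𝓕A(k) = 𝓕A(‖k‖ e₀)`, so `Φ` vanishes at every norm `‖n k₁ + j k₂‖`, `(n, j) ≠ 0`, of a rank-2 dual
sublattice.  These norms are SUPERLINEAR in the radius (J parallel lattice lines, each at most 2-to-1; two distinct lines
share finitely many norms — an integer-conic factorisation when the Gram data are commensurable, at most two
coincidences otherwise), whereas Jensen's inequality (`AnalyticOnNhd.sum_divisor_le`) lets a NONZERO entire function of
exponential type vanish at only `O(R)` points of `[0, R]`.  Hence `Φ ≡ 0`, `𝓕A ≡ 0` (radiality again), `A = 0` (Fourier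
inversion).  The d = 1 half: `α = T_a − ½(T_a(· − a/2) + T_a(· + a/2))` with `T_a` the tent of half-width `a`
(each tent family tiles `aℤ` to the constant `1`).
-/

noncomputable section

namespace Summit.AtomisticToContinuum.Crystallization.Cruxes.ExactCertificate.Invisibility

open Literature.MathematicalPhysics.StatisticalMechanics MeasureTheory Set Filter Topology
open Summit.AtomisticToContinuum.Crystallization.Theorems.ChargedEnergyGapNegative (E3)
open Summit.AtomisticToContinuum.Crystallization.Theorems.ChargedEnergyGapNegative.Blocks (zBasis)
open Summit.AtomisticToContinuum.Crystallization.Theorems.ThreeConeCertificateExactCertificate.Invisibility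
open scoped BigOperators FourierTransform RealInnerProductSpace

/-! ## The stubs (registered; workers land them under `Theorems/ThreeConeCertificateExactCertificateInvisibility*.lean`) -/












/-! ## Lead: two independent dual vectors of a full-rank lattice of `ℝ³` -/

/-- Every periodic configuration of `ℝ³` has two linearly independent DUAL vectors `k₁, k₂` (`⟪kᵢ, g⟫ ∈ ℤ` for
every period `g`): the first two vectors of the basis dual (for the inner product) to a `ℤ`-basis of the lattice. -/
theorem exists_dualVectors (P : PeriodicConfiguration 3) :
    ∃ k₁ k₂ : E3, LinearIndependent ℝ ![k₁, k₂] ∧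
      (∀ g ∈ P.lattice, ∃ n : ℤ, ⟪k₁, g⟫ = (n : ℝ)) ∧ (∀ g ∈ P.lattice, ∃ n : ℤ, ⟪k₂, g⟫ = (n : ℝ)) := by
  set b : Module.Basis (Fin 3) ℝ E3 := (zBasis P).ofZLatticeBasis ℝ P.lattice with hb
  -- the dual vectors: `⟪k i, v⟫ = b.repr v i`
  set k : Fin 3 → E3 := fun i =>
    (InnerProductSpace.toDual ℝ E3).symm (LinearMap.toContinuousLinearMap (b.coord i)) with hk
  have hkv : ∀ (i : Fin 3) (v : E3), ⟪k i, v⟫ = b.repr v i := by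
    intro i v
    rw [hk]
    simp only [InnerProductSpace.toDual_symm_apply, LinearMap.coe_toContinuousLinearMap', Module.Basis.coord_apply]
  have hkint : ∀ (i : Fin 3), ∀ g ∈ P.lattice, ∃ n : ℤ, ⟪k i, g⟫ = (n : ℝ) := by
    intro i g hg
    refine ⟨(zBasis P).repr ⟨g, hg⟩ i, ?_⟩
    rw [hkv, hb]
    exact Module.Basis.ofZLatticeBasis_repr_apply ℝ P.lattice (zBasis P) ⟨g, hg⟩ i
  have hkb : ∀ i i' : Fin 3, ⟪k i, b i'⟫ = if i' = i then 1 else 0 := by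
    intro i i'
    rw [hkv, b.repr_self, Finsupp.single_apply]
  refine ⟨k 0, k 1, ?_, hkint 0, hkint 1⟩
  rw [LinearIndependent.pair_iff]
  intro s t hst
  have h0 := congrArg (fun v => ⟪v, b 0⟫) hst
  have h1 := congrArg (fun v => ⟪v, b 1⟫) hst
  simp only [inner_add_left, real_inner_smul_left, hkb, inner_zero_left] at h0 h1
  simp at h0 h1
  exact ⟨h0, h1⟩

/-! ## Lead: the engine — an entire function of exponential type vanishing on the norms of a rank-2 lattice is zero -/

/-- **Engine.** An entire `Φ` of exponential type that vanishes at `‖n k₁ + j k₂‖` for all `(n, j) ≠ (0, 0)`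
(`k₁, k₂ ∈ ℝ³` independent) vanishes identically: the zeros are superlinear in the radius (stubs S4, S5), a nonzero
`Φ` has `O(R)` of them (stub S3). -/
theorem entire_eq_zero_of_vanish_on_latticeNorms (Φ : ℂ → ℂ) (hΦ : Differentiable ℂ Φ) {B τ : ℝ}
    (hB : ∀ z : ℂ, ‖Φ z‖ ≤ B * Real.exp (τ * ‖z‖)) {k₁ k₂ : E3} (hli : LinearIndependent ℝ ![k₁, k₂])
    (hz : ∀ n j : ℤ, (n, j) ≠ (0, 0) → Φ (‖(n : ℝ) • k₁ + (j : ℝ) • k₂‖ : ℂ) = 0) : ∀ z : ℂ, Φ z = 0 := by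
  by_contra h
  rw [not_forall] at h
  obtain ⟨c, hc⟩ := h
  obtain ⟨C₁, C₂, hcount⟩ := stub_jensenCount Φ B τ c hΦ hB hc
  obtain ⟨R, Z, hR, hcard, hZ⟩ := stub_normsSuperlinear stub_coincidenceFinite k₁ k₂ hli C₁ C₂
  have h1 := hcount R (Z.image fun s : ℝ => (s : ℂ)) hR ?_
  · rw [Finset.card_image_of_injective _ Complex.ofReal_injective] at h1
    linarith
  · intro z hz'
    obtain ⟨s, hs, rfl⟩ := Finset.mem_image.1 hz'
    obtain ⟨hsR, n, j, hnj, rfl⟩ := hZ s hs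
    refine ⟨?_, hz n j hnj⟩
    rw [Complex.norm_real, Real.norm_eq_abs, abs_of_nonneg (norm_nonneg _)]
    exact hsR

/-! ## Lead: no finite-range continuous radial kernel has Fourier transform vanishing on a lattice plane -/

/-- The unit vector `e₀` of the first axis. -/
def e₀ : E3 := EuclideanSpace.single (0 : Fin 3) (1 : ℝ)

theorem norm_e₀ : ‖e₀‖ = 1 := by
  simp [e₀]

theorem norm_smul_e₀ {s : ℝ} (hs : 0 ≤ s) : ‖s • e₀‖ = s := by
  rw [norm_smul, norm_e₀, mul_one, Real.norm_eq_abs, abs_of_nonneg hs]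

/-- A continuous radial profile vanishing on `[L, ∞)` gives a continuous, compactly supported, integrable kernel
`A = α∘‖·‖` on `ℝ³` vanishing outside the `L`-ball. -/
theorem radialKernel_props (α : ℝ → ℝ) (L : ℝ) (hα : Continuous α) (hL : ∀ r : ℝ, L ≤ r → α r = 0) :
    Continuous (fun v : E3 => (α ‖v‖ : ℂ)) ∧ Integrable (fun v : E3 => (α ‖v‖ : ℂ)) ∧
      ∀ v : E3, L < ‖v‖ → (α ‖v‖ : ℂ) = 0 := by
  have hc : Continuous fun v : E3 => (α ‖v‖ : ℂ) :=
    Complex.continuous_ofReal.comp (hα.comp continuous_norm)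
  have hsupp : ∀ v : E3, L < ‖v‖ → (α ‖v‖ : ℂ) = 0 := fun v hv => by
    rw [hL _ hv.le, Complex.ofReal_zero]
  have hcs : HasCompactSupport fun v : E3 => (α ‖v‖ : ℂ) := by
    refine HasCompactSupport.of_support_subset_isCompact (isCompact_closedBall (0 : E3) L) ?_
    intro v hv
    rw [Metric.mem_closedBall, dist_zero_right]
    by_contra h
    exact hv (hsupp v (not_le.1 h))
  exact ⟨hc, hc.integrable_of_hasCompactSupport hcs, hsupp⟩

/-- **No finite-range continuous radial kernel on `ℝ³` has Fourier transform vanishing on a lattice plane minus the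
origin.**  If `α` is continuous, vanishes on `[L, ∞)`, and `𝓕(α∘‖·‖)(n k₁ + j k₂) = 0` for all `(n, j) ≠ (0, 0)` with
`k₁, k₂` independent, then `α ≡ 0` on `[0, ∞)`. -/
theorem radial_eq_zero_of_fourier_vanish (α : ℝ → ℝ) (L : ℝ) (hα : Continuous α)
    (hL : ∀ r : ℝ, L ≤ r → α r = 0) {k₁ k₂ : E3} (hli : LinearIndependent ℝ ![k₁, k₂])
    (hz : ∀ n j : ℤ, (n, j) ≠ (0, 0) →
      𝓕 (fun v : E3 => (α ‖v‖ : ℂ)) ((n : ℝ) • k₁ + (j : ℝ) • k₂) = 0) :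
    ∀ r : ℝ, 0 ≤ r → α r = 0 := by
  obtain ⟨hAc, hAi, hAsupp⟩ := radialKernel_props α L hα hL
  obtain ⟨Φ, hΦd, ⟨B, τ, hB⟩, hΦF⟩ := stub_sliceEntire (fun v : E3 => (α ‖v‖ : ℂ)) L hAi hAsupp
  have hrad := stub_fourierRadial (fun r : ℝ => (α r : ℂ))
  -- zeros of `Φ` at the lattice norms
  have hzΦ : ∀ n j : ℤ, (n, j) ≠ (0, 0) → Φ (‖(n : ℝ) • k₁ + (j : ℝ) • k₂‖ : ℂ) = 0 := by
    intro n j hnj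
    have h := hΦF ‖(n : ℝ) • k₁ + (j : ℝ) • k₂‖
    rw [h, hrad _ ((n : ℝ) • k₁ + (j : ℝ) • k₂)]
    · exact hz n j hnj
    · rw [show (‖(n : ℝ) • k₁ + (j : ℝ) • k₂‖ • EuclideanSpace.single (0 : Fin 3) (1 : ℝ) : E3) =
          ‖(n : ℝ) • k₁ + (j : ℝ) • k₂‖ • e₀ from rfl, norm_smul_e₀ (norm_nonneg _)]
  have hΦ0 := entire_eq_zero_of_vanish_on_latticeNorms Φ hΦd hB hli hzΦ
  -- `𝓕A ≡ 0`
  have hFA : 𝓕 (fun v : E3 => (α ‖v‖ : ℂ)) = 0 := by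
    funext ξ
    have h1 := hrad ξ (‖ξ‖ • e₀) (by rw [norm_smul_e₀ (norm_nonneg _)])
    rw [h1, Pi.zero_apply, show (‖ξ‖ • e₀ : E3) = ‖ξ‖ • EuclideanSpace.single (0 : Fin 3) (1 : ℝ) from rfl,
      ← hΦF, hΦ0]
  -- Fourier inversion
  have hinv := hAc.fourierInv_fourier_eq hAi (by rw [hFA]; exact integrable_zero _ _ _)
  rw [hFA] at hinv
  intro r hr
  have hv := congrFun hinv (r • e₀)
  rw [Real.fourierInv_eq'] at hv
  simp only [Pi.zero_apply, smul_zero, integral_zero] at hv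
  rw [norm_smul_e₀ hr] at hv
  exact_mod_cast hv.symm

/-! ## Lead (wave 2): the theorem in every dimension, by Gram models in `ℝ³` -/

/-- **Gram model.** Positive binary Gram data `A > 0`, `B² < AC` are realised by two independent vectors of `ℝ³`:
`k₁ = (√A, 0, 0)`, `k₂ = (B/√A, √(C − B²/A), 0)`, with `‖n k₁ + j k₂‖² = A n² + 2B n j + C j²`. [folklore] -/
theorem exists_gramModel (A B C : ℝ) (hA : 0 < A) (hAC : B ^ 2 < A * C) :
    ∃ k₁ k₂ : E3, LinearIndependent ℝ ![k₁, k₂] ∧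
      ∀ n j : ℤ, ‖(n : ℝ) • k₁ + (j : ℝ) • k₂‖ ^ 2 = A * n ^ 2 + 2 * B * n * j + C * j ^ 2 := by
  set a : ℝ := Real.sqrt A with ha
  have ha0 : 0 < a := Real.sqrt_pos.2 hA
  have haa : a * a = A := Real.mul_self_sqrt hA.le
  set D : ℝ := C - B ^ 2 / A with hD
  have hD0 : 0 < D := by
    rw [hD, sub_pos, div_lt_iff₀ hA]; linarith
  set e : ℝ := Real.sqrt D with he
  have he0 : 0 < e := Real.sqrt_pos.2 hD0
  have hee : e * e = D := Real.mul_self_sqrt hD0.le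
  set k₁ : E3 := !₂[a, 0, 0] with hk₁
  set k₂ : E3 := !₂[B / a, e, 0] with hk₂
  refine ⟨k₁, k₂, ?_, fun n j => ?_⟩
  · rw [LinearIndependent.pair_iff]
    intro s t hst
    have h0 := congrArg (fun v : E3 => v 0) hst
    have h1 := congrArg (fun v : E3 => v 1) hst
    simp [hk₁, hk₂] at h0 h1
    have ht : t = 0 := by
      rcases h1 with h1 | h1
      · exact h1
      · exact absurd h1 he0.ne'
    subst ht
    simp at h0
    rcases h0 with h0 | h0
    · exact ⟨h0, rfl⟩
    · exact absurd h0 ha0.ne'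
  · have hc0 : ((n : ℝ) • k₁ + (j : ℝ) • k₂) 0 = n * a + j * (B / a) := by simp [hk₁, hk₂]
    have hc1 : ((n : ℝ) • k₁ + (j : ℝ) • k₂) 1 = j * e := by simp [hk₁, hk₂]
    have hc2 : ((n : ℝ) • k₁ + (j : ℝ) • k₂) 2 = 0 := by simp [hk₁, hk₂]
    rw [EuclideanSpace.norm_eq, Real.sq_sqrt (Finset.sum_nonneg fun _ _ => sq_nonneg _), Fin.sum_univ_three,
      hc0, hc1, hc2]
    simp only [Real.norm_eq_abs, sq_abs]
    have hC : C = e * e + B ^ 2 / (a * a) := by rw [hee, hD, haa]; ring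
    rw [hC, ← haa]
    field_simp
    ring

/-- **No finite-range continuous radial kernel on `ℝᵈ` has Fourier transform vanishing on a lattice plane minus the
origin (every `d`).**  If `k₁, k₂ ∈ ℝᵈ` are independent and `α : ℝ → ℝ` is continuous, vanishes on `[L, ∞)`, and
`𝓕(α∘‖·‖)(n k₁ + j k₂) = 0` for all `(n, j) ≠ (0, 0)`, then `α ≡ 0` on `[0, ∞)`. [folklore] -/
theorem radial_eq_zero_of_fourier_vanish_dim {d : ℕ} {k₁ k₂ : EuclideanSpace ℝ (Fin d)}
    (hli : LinearIndependent ℝ ![k₁, k₂]) (α : ℝ → ℝ) (L : ℝ) (hα : Continuous α)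
    (hL : ∀ r : ℝ, L ≤ r → α r = 0)
    (hz : ∀ n j : ℤ, (n, j) ≠ (0, 0) →
      𝓕 (fun v : EuclideanSpace ℝ (Fin d) => (α ‖v‖ : ℂ)) ((n : ℝ) • k₁ + (j : ℝ) • k₂) = 0) :
    ∀ r : ℝ, 0 ≤ r → α r = 0 := by
  -- `d ≥ 1`: an axis exists
  have hk₁0 : k₁ ≠ 0 := by
    have := hli.ne_zero 0
    simpa using this
  have hd : 0 < d := by
    rcases Nat.eq_zero_or_pos d with rfl | hd
    · exact absurd (Subsingleton.elim k₁ 0) hk₁0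
    · exact hd
  set i₀ : Fin d := ⟨0, hd⟩
  -- the kernel on `ℝᵈ`
  set Ad : EuclideanSpace ℝ (Fin d) → ℂ := fun v => (α ‖v‖ : ℂ) with hAd
  have hAc : Continuous Ad := Complex.continuous_ofReal.comp (hα.comp continuous_norm)
  have hAsupp : ∀ v : EuclideanSpace ℝ (Fin d), L < ‖v‖ → Ad v = 0 := fun v hv => by
    simp only [hAd]; rw [hL _ hv.le, Complex.ofReal_zero]
  have hAcs : HasCompactSupport Ad := by
    refine HasCompactSupport.of_support_subset_isCompact (isCompact_closedBall (0 : EuclideanSpace ℝ (Fin d)) L) ?_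
    intro v hv
    rw [Metric.mem_closedBall, dist_zero_right]
    by_contra h
    exact hv (hAsupp v (not_le.1 h))
  have hAi : Integrable Ad := hAc.integrable_of_hasCompactSupport hAcs
  obtain ⟨Φ, hΦd, ⟨Bc, τ, hB⟩, hΦF⟩ := stub_sliceEntireDim d i₀ Ad L hAi hAsupp
  have hrad := stub_fourierRadialDim d (fun r : ℝ => (α r : ℂ))
  have hnorm : ∀ {s : ℝ}, 0 ≤ s → ‖s • (EuclideanSpace.single i₀ (1 : ℝ) : EuclideanSpace ℝ (Fin d))‖ = s := by
    intro s hs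
    rw [norm_smul, Real.norm_eq_abs, abs_of_nonneg hs]
    simp
  -- Gram data of `k₁, k₂` and a model pair in `ℝ³`
  set A : ℝ := ‖k₁‖ ^ 2
  set B : ℝ := ⟪k₁, k₂⟫
  set C : ℝ := ‖k₂‖ ^ 2
  have hA : 0 < A := by positivity
  have hAC : B ^ 2 < A * C := by
    -- strict Cauchy–Schwarz from independence
    have hle : B ^ 2 ≤ A * C := by
      have := abs_real_inner_le_norm k₁ k₂
      have h' : |B| ^ 2 ≤ (‖k₁‖ * ‖k₂‖) ^ 2 := by gcongr
      rw [sq_abs] at h'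
      simpa [A, C, mul_pow] using h'
    rcases hle.lt_or_eq with hlt | heq
    · exact hlt
    · exfalso
      have hk₂0 : k₂ ≠ 0 := by
        have := hli.ne_zero 1
        simpa using this
      have h1 : |⟪k₁, k₂⟫ / (‖k₁‖ * ‖k₂‖)| = 1 := by
        rw [abs_div, abs_mul, abs_norm, abs_norm, div_eq_one_iff_eq (by positivity)]
        have : |⟪k₁, k₂⟫| ^ 2 = (‖k₁‖ * ‖k₂‖) ^ 2 := by rw [sq_abs]; simpa [A, C, mul_pow] using heq
        exact (abs_eq_abs.2 (Or.inl rfl)).trans ((sq_eq_sq₀ (abs_nonneg _) (by positivity)).1 this)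
      obtain ⟨-, r, hr, hr'⟩ := (abs_real_inner_div_norm_mul_norm_eq_one_iff k₁ k₂).1 h1
      rw [LinearIndependent.pair_iff] at hli
      have := hli r (-1) (by rw [hr']; simp)
      norm_num at this
  obtain ⟨m₁, m₂, hli3, hgram⟩ := exists_gramModel A B C hA hAC
  have hnormeq : ∀ n j : ℤ, ‖(n : ℝ) • k₁ + (j : ℝ) • k₂‖ = ‖(n : ℝ) • m₁ + (j : ℝ) • m₂‖ := by
    intro n j
    have hsq : ‖(n : ℝ) • k₁ + (j : ℝ) • k₂‖ ^ 2 = A * n ^ 2 + 2 * B * n * j + C * j ^ 2 := by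
      rw [norm_add_sq_real, norm_smul, norm_smul, real_inner_smul_left, real_inner_smul_right,
        Real.norm_eq_abs, Real.norm_eq_abs, mul_pow, mul_pow, sq_abs, sq_abs]
      ring
    exact (sq_eq_sq₀ (norm_nonneg _) (norm_nonneg _)).1 (by rw [hsq, hgram])
  -- zeros of `Φ` at the model lattice norms
  have hzΦ : ∀ n j : ℤ, (n, j) ≠ (0, 0) → Φ (‖(n : ℝ) • m₁ + (j : ℝ) • m₂‖ : ℂ) = 0 := by
    intro n j hnj
    rw [← hnormeq, hΦF ‖(n : ℝ) • k₁ + (j : ℝ) • k₂‖, hrad _ ((n : ℝ) • k₁ + (j : ℝ) • k₂) (hnorm (norm_nonneg _))]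
    exact hz n j hnj
  have hΦ0 := entire_eq_zero_of_vanish_on_latticeNorms Φ hΦd hB hli3 hzΦ
  -- `𝓕A ≡ 0`, inversion
  have hFA : 𝓕 Ad = 0 := by
    funext ξ
    rw [hrad ξ (‖ξ‖ • EuclideanSpace.single i₀ (1 : ℝ)) (by rw [hnorm (norm_nonneg _)]), Pi.zero_apply,
      ← hΦF, hΦ0]
  have hinv := hAc.fourierInv_fourier_eq hAi (by rw [hFA]; exact integrable_zero _ _ _)
  rw [hFA] at hinv
  intro r hr
  have hv := congrFun hinv (r • EuclideanSpace.single i₀ (1 : ℝ))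
  rw [Real.fourierInv_eq'] at hv
  simp only [Pi.zero_apply, smul_zero, integral_zero] at hv
  have : Ad (r • EuclideanSpace.single i₀ (1 : ℝ)) = 0 := hv.symm
  simp only [hAd, hnorm hr] at this
  exact_mod_cast this

/-! ## Lead: the Bravais crystal version and the deciding statement -/

/-- **No finite-range continuous radial kernel is invisible to a Bravais crystal of `ℝ³`.** -/
theorem bravais_noInvisibleKernel (P : PeriodicConfiguration 3) (hP : P.motif.card = 1) (α : ℝ → ℝ) (L : ℝ)
    (hα : Continuous α) (hL : ∀ r : ℝ, L ≤ r → α r = 0)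
    (hinv : ∀ w : E3, HasSum (fun y : P.points => α (dist w (y : E3))) 0) :
    ∀ r : ℝ, 0 ≤ r → α r = 0 := by
  obtain ⟨k₁, k₂, hli, hk₁, hk₂⟩ := exists_dualVectors P
  obtain ⟨-, hAi, -⟩ := radialKernel_props α L hα hL
  obtain ⟨x₀, hx₀⟩ := Finset.card_eq_one.1 hP
  refine radial_eq_zero_of_fourier_vanish α L hα hL hli fun n j _ => ?_
  have hdual : ∀ g ∈ P.lattice, ∃ m : ℤ, ⟪(n : ℝ) • k₁ + (j : ℝ) • k₂, g⟫ = (m : ℝ) := by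
    intro g hg
    obtain ⟨p, hp⟩ := hk₁ g hg
    obtain ⟨q, hq⟩ := hk₂ g hg
    refine ⟨n * p + j * q, ?_⟩
    rw [inner_add_left, real_inner_smul_left, real_inner_smul_left, hp, hq]
    push_cast
    ring
  have h := stub_braggOfInvisible P α L hL hAi hinv _ hdual
  rw [hx₀, Finset.sum_singleton] at h
  exact (mul_eq_zero.1 h).resolve_left (Complex.exp_ne_zero _)

/-- **The deciding statement of skeleton VIII: THE INVISIBILITY DICHOTOMY.**  (d = 3) For every Bravais periodic
configuration `P ⊂ ℝ³` (one-point motif), every continuous `α : ℝ → ℝ` vanishing on `[L, ∞)` whose field on the crystal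
vanishes identically (`Σ_{y ∈ P} α(dist w y) = 0` for all `w`) is `≡ 0` on `[0, ∞)`.  (d = 1) For every `a > 0` there is
a continuous `α` with `α 0 ≠ 0`, vanishing on `[L, ∞)`, whose field on the chain `aℤ` vanishes identically. -/
def InvisibilityDichotomy : Prop :=
  (∀ (P : PeriodicConfiguration 3) (α : ℝ → ℝ) (L : ℝ), P.motif.card = 1 → Continuous α →
      (∀ r : ℝ, L ≤ r → α r = 0) →
      (∀ w : EuclideanSpace ℝ (Fin 3),
        HasSum (fun y : P.points => α (dist w (y : EuclideanSpace ℝ (Fin 3)))) 0) →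
      ∀ r : ℝ, 0 ≤ r → α r = 0) ∧
  (∀ a : ℝ, 0 < a → ∃ (α : ℝ → ℝ) (L : ℝ), Continuous α ∧ α 0 ≠ 0 ∧
      (∀ r : ℝ, L ≤ r → α r = 0) ∧ ∀ w : ℝ, HasSum (fun n : ℤ => α |w - n * a|) 0)

/-- **Composition: the stubs close `InvisibilityDichotomy`.** -/
theorem InvisibilityDichotomy_of : InvisibilityDichotomy :=
  ⟨fun P α L hP hα hL hinv => bravais_noInvisibleKernel P hP α L hα hL hinv, stub_oneDimKernel⟩

/-- The same through the registered assembly stub (statement = definiens verbatim). -/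
theorem InvisibilityDichotomy_of' : InvisibilityDichotomy := stub_invisibilityAssembly

/-- **Wave 2: the `d ≥ 2` half in EVERY dimension** (Fourier form): composed above modulo `stub_sliceEntireDim`,
`stub_fourierRadialDim`; equivalently the registered `stub_dimAssembly`. -/
theorem invisibility_allDim : ∀ (d : ℕ) (k₁ k₂ : EuclideanSpace ℝ (Fin d)), LinearIndependent ℝ ![k₁, k₂] →
    ∀ (α : ℝ → ℝ) (L : ℝ), Continuous α → (∀ r : ℝ, L ≤ r → α r = 0) →
    (∀ n j : ℤ, (n, j) ≠ (0, 0) →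
      𝓕 (fun v : EuclideanSpace ℝ (Fin d) => (α ‖v‖ : ℂ)) ((n : ℝ) • k₁ + (j : ℝ) • k₂) = 0) →
    ∀ r : ℝ, 0 ≤ r → α r = 0 :=
  fun _ _ _ hli α L hα hL hz => radial_eq_zero_of_fourier_vanish_dim hli α L hα hL hz

end Summit.AtomisticToContinuum.Crystallization.Cruxes.ExactCertificate.Invisibility

end
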